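import Summits.MatrixMultiplication.OmegaCensus.ThreeSetZ29Norm4514JoinK1Q6
import Summits.MatrixMultiplication.OmegaCensus.ThreeSetZ29Norm4514JoinK2T0
import Summits.MatrixMultiplication.OmegaCensus.ThreeSetZ29Norm4514JoinK3T0
import Summits.MatrixMultiplication.OmegaCensus.ThreeSetZ29Norm4514JoinK4T0
import Summits.MatrixMultiplication.OmegaCensus.ThreeSetLineParity
import HarnessLib

/-!
# `(4,5,14)@841`: the W-killers admit no `X`-datum (join; the semantic hypothesis `hkill` of `ThreeSetZpCells4Core`) — norm-filter route

ω-census `pub-omega`, family (b3), seat pub-omega-group gen 41.  Framing: lottery ticket; floor = certified bounds/negative ranges.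
VALUE: the finite half of the kernel route for the census cell `(4,5,14)@841`; killer `0` by parity (`LineInv.no_line_identity3_of_even`),
killers `1…4` by their block-assembly files `ThreeSetZ29Norm4514JoinK*P*` (certificate-free norm filter).  NOT progress on ω.
-/

namespace Summit.MatrixMultiplication.OmegaCensus

namespace Z29Norm4514

/-- **The killer facts for `(4,5,14)@841`** in the semantic shape of `hkill` (`ThreeSetZpCells4Core`). [folklore] -/
theorem killers : ∀ k, k < 5 → ∀ Fl ∈ ZpZpDomino.compsLit 29 5, ∀ (G : ZMod 29 → ℕ) (s : ZMod 29), (∀ u, G u ≤ 14) →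
    ¬ ∀ τ : ZMod 29, (∑ u : ZMod 29, lineMat3 (vecFn ((([[0,0,0,0,0,0,0,0,0,0,0,0,0,0,0,0,0,0,0,0,0,0,0,0,0,0,0,2,2], [0,0,0,0,0,0,0,0,0,0,0,0,0,0,0,0,0,0,0,0,0,0,0,0,0,0,1,1,2], [0,0,0,0,0,0,0,0,0,0,0,0,0,0,0,0,0,0,0,0,0,0,0,0,1,0,1,1,1], [0,0,0,0,0,0,0,0,0,0,0,0,0,0,0,0,0,0,0,0,0,1,0,0,0,1,1,0,1], [0,0,0,0,0,0,0,0,0,0,0,0,0,0,0,0,0,0,0,0,1,0,0,0,1,0,0,1,1]] : List (List ℕ))).getD k [])) (vecFn Fl) τ u * G u) +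
      (if s = τ then 1 else 0) = 29 := by
  intro k hk
  interval_cases k
  · -- killer 0: all entries even, `K = 29` odd: parity
    intro Fl _ G s _ hid
    exact LineInv.no_line_identity3_of_even (W := vecFn ((([[0,0,0,0,0,0,0,0,0,0,0,0,0,0,0,0,0,0,0,0,0,0,0,0,0,0,0,2,2], [0,0,0,0,0,0,0,0,0,0,0,0,0,0,0,0,0,0,0,0,0,0,0,0,0,0,1,1,2], [0,0,0,0,0,0,0,0,0,0,0,0,0,0,0,0,0,0,0,0,0,0,0,0,1,0,1,1,1], [0,0,0,0,0,0,0,0,0,0,0,0,0,0,0,0,0,0,0,0,0,1,0,0,0,1,1,0,1], [0,0,0,0,0,0,0,0,0,0,0,0,0,0,0,0,0,0,0,0,1,0,0,0,1,0,0,1,1]] : List (List ℕ))).getD 0 []))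
      (fun v => by
        unfold vecFn
        have hv := ZMod.val_lt v
        interval_cases hh : v.val <;> decide) (by norm_num) (by norm_num) (vecFn Fl) G s hid
  · exact killer1_all
  · exact killer2_all
  · exact killer3_all
  · exact killer4_all

end Z29Norm4514

end Summit.MatrixMultiplication.OmegaCensus
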